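import Summits.ResolutionOfSingularities.ResolutionOfSingularities.Theorems.MarkedTransferCampaignW46MohWindowSurfaceCentreFibre
import Mathlib.Algebra.MvPolynomial.Division
import HarnessLib

/-!
# [OURS · L1 W4.6 rung (iii-2)] Surface Moh window — the EXCEPTIONAL LINE `{c_j = 0, z/c_j = 0}` of a Rees chart and the COUNT
# of its primes through a given polynomial (cell res-hironaka, LADDER-RESOLUTION rung L, D-0089; seat res-L1-s46-pv-5 gen 5; host
# MarkedTransfer, `--supports stmt-ResolutionOfSingularities-16155 --as helper`; statement file `…CampaignW46MohWindowSurface.lean`)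

HONEST FRAMING. Nothing here is a statement of H. Hironaka's manuscript [Hironaka2017] and nothing here asserts that any
statement of it holds. Pure commutative algebra for the CHILD-COUNT lemma of the surface window (successor file
`…ChildCount.lean`: over an admitted centre of `Regime.mohWindowSurface`, any `p`, the transform has at most `2d ≤ 2(2p − 1)`
singular points) — the input res-L1-type-o1 recorded as missing for a numeric exit bound of the TAME rung («the multiset argument
gives no honest numeric β without a child-count lemma», `…MohWindowSurface.lean` §5). For the Rees chart `B_j = R[𝔪/c_j]` of a
regular local `R` of embedding dimension `3` (`(c₀, c₁, c₂) = 𝔪`), the primes `𝔴 ⊇ (c_j, c₂/c_j)` — the points of the LINE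
`ℓ_j ≅ 𝔸¹_κ` of the exceptional plane `B_j/(c_j) ≅ κ[T_a, T₂]` (tree `chartQuotEquiv`, [StacksProject] Tag 0BIQ) cut out by `T₂` —
containing a given `S̃ ∈ B_j` whose image on the line is a nonzero polynomial `F ∈ κ[X]` are at most `deg F` in number: they
inject into the primes of `κ[X]` through `F`. AI-written; AI review is weaker than expert review. No `sorry`; axioms standard.

WHAT IS PROVED (namespace `…CampaignW46.MohWindowSurface`).
* `exists_eval₂_eq_of_forall_coeff`, `le_of_comap_line_le` — two-variable polynomial algebra: modulo `X_b` a polynomial in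
  `{X_a, X_b}` comes from `κ[X]` (`X ↦ X_a`); an ideal containing `X_b` is determined by its trace on that line.
* `ncard_primes_mem_le_natDegree` — over a field, the primes of `κ[X]` containing `F ≠ 0` are finite, at most `deg F` of them.
* `chartQuotLift_chartBase`, `chartQuotLift_chartGen`, `comap_chartQuotLift_map` — the map `B_j → B_j/(c_j) ≅ κ[T_l : l ≠ j]`.
* `ncard_linePrimes_le` — **the count**: `#{𝔴 ∈ Spec B_j | c_j, c₂/c_j, S̃ ∈ 𝔴} ≤ deg F` whenever `S̃ ≡ F(c_a/c_j)` on the line.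
[ZariskiSamuel1960] [Matsumura1987] [StacksProject]
-/

noncomputable section

set_option linter.dupNamespace false -- mandated namespace of this single-conjunct summit

open IsLocalRing

namespace Summit.ResolutionOfSingularities.ResolutionOfSingularities.Theorems

namespace CampaignW46

namespace MohWindowSurface

open Literature.AlgebraicGeometry.Resolution

universe u

/-! ## 1. Two-variable polynomial algebra: the line `X_b = 0` -/

section TwoVars

variable {κ : Type*} [CommRing κ] {σ : Type*} {a b : σ}

/-- A polynomial in the two letters `X_a, X_b` none of whose monomials involves `X_b` is the image of a one-variable polynomial
under `X ↦ X_a`. [folklore] -/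
theorem exists_eval₂_eq_of_forall_coeff (hσ : ∀ l : σ, l = a ∨ l = b) (hab : a ≠ b) (r : MvPolynomial σ κ)
    (hr : ∀ m ∈ r.support, m b = 0) :
    ∃ q : Polynomial κ, Polynomial.eval₂RingHom (MvPolynomial.C : κ →+* MvPolynomial σ κ) (MvPolynomial.X a) q = r := by
  classical
  refine ⟨∑ m ∈ r.support, Polynomial.monomial (m a) (MvPolynomial.coeff m r), ?_⟩
  rw [map_sum]
  conv_rhs => rw [← MvPolynomial.support_sum_monomial_coeff r]
  refine Finset.sum_congr rfl fun m hm => ?_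
  have hm' : Finsupp.single a (m a) = m := by
    ext l
    rcases hσ l with rfl | rfl
    · rw [Finsupp.single_eq_same]
    · rw [Finsupp.single_apply, if_neg hab, hr m hm]
  rw [Polynomial.coe_eval₂RingHom, Polynomial.eval₂_monomial, MvPolynomial.C_mul_X_pow_eq_monomial, hm']

/-- **An ideal containing `X_b` is determined by its trace on the line `X ↦ X_a`**: if `X_b ∈ 𝔓, 𝔓′` and the preimage of `𝔓`
in `κ[X]` is contained in that of `𝔓′`, then `𝔓 ≤ 𝔓′` (divide by `X_b`: `MvPolynomial.divMonomial_add_modMonomial_single`).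
[folklore] -/
theorem le_of_comap_line_le (hσ : ∀ l : σ, l = a ∨ l = b) (hab : a ≠ b) {𝔓 𝔓' : Ideal (MvPolynomial σ κ)}
    (hb : (MvPolynomial.X b : MvPolynomial σ κ) ∈ 𝔓) (hb' : (MvPolynomial.X b : MvPolynomial σ κ) ∈ 𝔓')
    (h : 𝔓.comap (Polynomial.eval₂RingHom (MvPolynomial.C : κ →+* MvPolynomial σ κ) (MvPolynomial.X a)) ≤
      𝔓'.comap (Polynomial.eval₂RingHom (MvPolynomial.C : κ →+* MvPolynomial σ κ) (MvPolynomial.X a))) :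
    𝔓 ≤ 𝔓' := by
  classical
  intro x hx
  have hsplit := MvPolynomial.divMonomial_add_modMonomial_single x b
  have hr : ∀ m ∈ (MvPolynomial.modMonomial x (Finsupp.single b 1)).support, m b = 0 := by
    intro m hm
    by_contra hmb
    have hle : Finsupp.single b 1 ≤ m := Finsupp.single_le_iff.mpr (Nat.one_le_iff_ne_zero.mpr hmb)
    exact (MvPolynomial.mem_support_iff.mp hm) (MvPolynomial.coeff_modMonomial_of_le x hle)
  obtain ⟨q, hq⟩ := exists_eval₂_eq_of_forall_coeff hσ hab _ hr
  have hrP : MvPolynomial.modMonomial x (Finsupp.single b 1) ∈ 𝔓 := by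
    have heq : MvPolynomial.modMonomial x (Finsupp.single b 1) =
        x - MvPolynomial.X b * MvPolynomial.divMonomial x (Finsupp.single b 1) := by
      linear_combination hsplit
    rw [heq]
    exact Ideal.sub_mem _ hx (Ideal.mul_mem_right _ _ hb)
  have hq𝔓 : q ∈ 𝔓.comap (Polynomial.eval₂RingHom (MvPolynomial.C : κ →+* MvPolynomial σ κ) (MvPolynomial.X a)) := by
    rw [Ideal.mem_comap, hq]; exact hrP
  have hq𝔓' := h hq𝔓
  rw [Ideal.mem_comap, hq] at hq𝔓'
  rw [← hsplit]
  exact Ideal.add_mem _ (Ideal.mul_mem_right _ _ hb') hq𝔓'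

end TwoVars

/-! ## 2. Primes of `κ[X]` through a nonzero polynomial -/

section OneVar

variable {κ : Type*} [Field κ]

/-- **Over a field, the prime ideals of `κ[X]` containing a nonzero `F` are finite in number, at most `deg F`** (each is `(π)`
for a monic irreducible factor `π` of `F`; induction on the degree). [folklore] -/
theorem ncard_primes_mem_le_natDegree (F : Polynomial κ) (hF : F ≠ 0) :
    {𝔭 : Ideal (Polynomial κ) | 𝔭.IsPrime ∧ F ∈ 𝔭}.Finite ∧ {𝔭 : Ideal (Polynomial κ) | 𝔭.IsPrime ∧ F ∈ 𝔭}.ncard ≤ F.natDegree := by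
  classical
  induction hn : F.natDegree using Nat.strong_induction_on generalizing F with
  | _ n ih =>
    by_cases hS : {𝔭 : Ideal (Polynomial κ) | 𝔭.IsPrime ∧ F ∈ 𝔭} = ∅
    · rw [hS]; exact ⟨Set.finite_empty, by rw [Set.ncard_empty]; exact Nat.zero_le _⟩
    · obtain ⟨𝔭₀, h𝔭₀, hF𝔭₀⟩ := Set.nonempty_iff_ne_empty.mpr hS
      haveI := h𝔭₀
      have h𝔭₀ne : 𝔭₀ ≠ ⊥ := fun h => hF (by rw [h, Ideal.mem_bot] at hF𝔭₀; exact hF𝔭₀)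
      -- `𝔭₀ = (π)`, `π` prime, `F = π · ψ`
      obtain ⟨π, hπ⟩ := (IsPrincipalIdealRing.principal 𝔭₀).principal
      have hπ' : 𝔭₀ = Ideal.span {π} := hπ
      have hπ0 : π ≠ 0 := fun h => h𝔭₀ne (by rw [hπ', h, Ideal.span_singleton_eq_bot])
      have hπprime : Prime π := (Ideal.span_singleton_prime hπ0).mp (hπ' ▸ h𝔭₀)
      obtain ⟨ψ, hψ⟩ : π ∣ F := Ideal.mem_span_singleton.mp (hπ' ▸ hF𝔭₀)
      have hψ0 : ψ ≠ 0 := fun h => hF (by rw [hψ, h, mul_zero])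
      have hdegπ : 1 ≤ π.natDegree := by
        rw [Nat.one_le_iff_ne_zero]
        intro h0
        exact hπprime.not_unit (Polynomial.isUnit_iff_degree_eq_zero.mpr (Polynomial.degree_eq_natDegree hπ0 ▸ by
          rw [h0]; rfl))
      have hdeg : F.natDegree = π.natDegree + ψ.natDegree := by rw [hψ, Polynomial.natDegree_mul hπ0 hψ0]
      have hψn : ψ.natDegree < n := by omega
      obtain ⟨hfinψ, hcardψ⟩ := ih ψ.natDegree hψn ψ hψ0 rfl
      -- `{primes ∋ F} ⊆ {𝔭₀} ∪ {primes ∋ ψ}`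
      have hmax : 𝔭₀.IsMaximal := IsPrime.to_maximal_ideal h𝔭₀ne
      have hsub : {𝔭 : Ideal (Polynomial κ) | 𝔭.IsPrime ∧ F ∈ 𝔭} ⊆
          {𝔭₀} ∪ {𝔭 : Ideal (Polynomial κ) | 𝔭.IsPrime ∧ ψ ∈ 𝔭} := by
        rintro 𝔭 ⟨h𝔭, hF𝔭⟩
        rw [hψ] at hF𝔭
        rcases h𝔭.mem_or_mem hF𝔭 with h | h
        · left
          have hle : 𝔭₀ ≤ 𝔭 := by rw [hπ', Ideal.span_le, Set.singleton_subset_iff]; exact h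
          exact (hmax.eq_of_le h𝔭.ne_top hle).symm
        · right; exact ⟨h𝔭, h⟩
      have hfin : ({𝔭₀} ∪ {𝔭 : Ideal (Polynomial κ) | 𝔭.IsPrime ∧ ψ ∈ 𝔭}).Finite := (Set.finite_singleton _).union hfinψ
      refine ⟨hfin.subset hsub, ?_⟩
      calc {𝔭 : Ideal (Polynomial κ) | 𝔭.IsPrime ∧ F ∈ 𝔭}.ncard
          ≤ ({𝔭₀} ∪ {𝔭 : Ideal (Polynomial κ) | 𝔭.IsPrime ∧ ψ ∈ 𝔭}).ncard := Set.ncard_le_ncard hsub hfin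
        _ ≤ ({𝔭₀} : Set (Ideal (Polynomial κ))).ncard + {𝔭 : Ideal (Polynomial κ) | 𝔭.IsPrime ∧ ψ ∈ 𝔭}.ncard :=
            Set.ncard_union_le _ _
        _ ≤ 1 + ψ.natDegree := by rw [Set.ncard_singleton]; exact Nat.add_le_add_left hcardψ 1
        _ ≤ n := by omega

end OneVar

/-! ## 3. The Rees chart modulo the exceptional divisor: `B_j → B_j/(c_j) ≅ κ[T_l : l ≠ j]` -/

section Chart

variable {R : Type u} [CommRing R] [IsRegularLocalRing R]

/-- The regular system of parameters `c` of a regular local ring of embedding dimension `3` is quasi-regular (tree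
`isQuasiRegular_centre`, no extra letters). [folklore] -/
theorem isQuasiRegular_of_span_eq (h3 : (maximalIdeal R).spanFinrank = 3) (c : Fin 3 → R)
    (hc : Ideal.span (Set.range c) = maximalIdeal R) : IsQuasiRegular c := by
  have hz0 : Ideal.span (Set.range (Fin.append c (fun k : Fin 0 => Fin.elim0 k : Fin 0 → R))) = maximalIdeal R := by
    rw [span_range_append_elim0]; exact hc
  exact isQuasiRegular_centre c (fun k : Fin 0 => Fin.elim0 k) hz0 (by rw [h3])

variable (h3 : (maximalIdeal R).spanFinrank = 3) (c : Fin 3 → R) (hc : Ideal.span (Set.range c) = maximalIdeal R) (j : Fin 3)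

/-- `B_j → κ[T_l : l ≠ j]` (`κ = R/(c) = R/𝔪`): reduce modulo `c_j` and invert the tree's `chartQuotEquiv`. On `R`: the residue
class as a constant. [folklore] -/
theorem chartQuotLift_chartBase (r : R) :
    ((chartQuotEquiv c j (isQuasiRegular_of_span_eq h3 c hc)).symm.toRingHom.comp
        (Ideal.Quotient.mk (Ideal.span {chartBase c j (c j)}))) (chartBase c j r) =
      MvPolynomial.C (Ideal.Quotient.mk (Ideal.span (Set.range c)) r) := by
  rw [RingHom.comp_apply, RingEquiv.toRingHom_eq_coe, RingHom.coe_coe, RingEquiv.symm_apply_eq, chartQuotEquiv_apply,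
    chartQuotMap_C]

/-- The same map on a chart generator `c_l/c_j`, `l ≠ j`: the variable `T_l`. [folklore] -/
theorem chartQuotLift_chartGen (l : Fin 3) (hl : l ≠ j) :
    ((chartQuotEquiv c j (isQuasiRegular_of_span_eq h3 c hc)).symm.toRingHom.comp
        (Ideal.Quotient.mk (Ideal.span {chartBase c j (c j)}))) (chartGen c j l) =
      MvPolynomial.X ⟨l, hl⟩ := by
  rw [RingHom.comp_apply, RingEquiv.toRingHom_eq_coe, RingHom.coe_coe, RingEquiv.symm_apply_eq, chartQuotEquiv_apply,
    chartQuotMap_X]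

/-- The map `B_j → κ[T_l : l ≠ j]` is surjective. [folklore] -/
theorem chartQuotLift_surjective :
    Function.Surjective ((chartQuotEquiv c j (isQuasiRegular_of_span_eq h3 c hc)).symm.toRingHom.comp
      (Ideal.Quotient.mk (Ideal.span {chartBase c j (c j)}))) := by
  rw [RingHom.coe_comp]
  exact (chartQuotEquiv c j (isQuasiRegular_of_span_eq h3 c hc)).symm.surjective.comp Ideal.Quotient.mk_surjective

/-- An ideal of `B_j` containing `c_j` is the preimage of its image in `κ[T_l : l ≠ j]`. [folklore] -/
theorem comap_chartQuotLift_map {w : Ideal (chartRing c j)} (hw : chartBase c j (c j) ∈ w) :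
    (w.map ((chartQuotEquiv c j (isQuasiRegular_of_span_eq h3 c hc)).symm.toRingHom.comp
      (Ideal.Quotient.mk (Ideal.span {chartBase c j (c j)})))).comap
        ((chartQuotEquiv c j (isQuasiRegular_of_span_eq h3 c hc)).symm.toRingHom.comp
          (Ideal.Quotient.mk (Ideal.span {chartBase c j (c j)}))) = w := by
  rw [Ideal.comap_map_of_surjective _ (chartQuotLift_surjective h3 c hc j), sup_eq_left]
  intro x hx
  rw [Ideal.mem_comap, Ideal.mem_bot, RingHom.comp_apply, RingEquiv.toRingHom_eq_coe, RingHom.coe_coe,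
    map_eq_zero_iff _ (chartQuotEquiv c j (isQuasiRegular_of_span_eq h3 c hc)).symm.injective,
    Ideal.Quotient.eq_zero_iff_mem] at hx
  exact (Ideal.span_le.mpr (Set.singleton_subset_iff.mpr hw)) hx

/-! ## 4. The count of primes on the exceptional line through a given polynomial -/

include h3 hc in
/-- **[OURS · L1 W4.6 rung (iii-2)] THE PRIMES OF THE EXCEPTIONAL LINE THROUGH A POLYNOMIAL ARE AT MOST ITS DEGREE IN NUMBER.**
`R` regular local of embedding dimension `3` with `(c₀, c₁, c₂) = 𝔪`; `j, a, 2` the three indices; `S̃ ∈ B_j = R[𝔪/c_j]` whose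
reduction modulo `c_j` is `F(T_a)` for a nonzero `F ∈ κ[X]` (`κ = R/𝔪`). Then the set of primes `𝔴` of `B_j` with
`c_j, c₂/c_j, S̃ ∈ 𝔴` is finite of cardinality `≤ deg F`: `𝔴 ↦` (trace on the line `X ↦ T_a` of the image of `𝔴` in `κ[T_a, T₂]`)
is an injection into the primes of `κ[X]` through `F` (`le_of_comap_line_le`, `comap_chartQuotLift_map`,
`ncard_primes_mem_le_natDegree`). NOT a statement of the manuscript. [folklore] -/
theorem ncard_linePrimes_le {a : Fin 3} (hja : a ≠ j) (h2j : (2 : Fin 3) ≠ j) (ha2 : a ≠ 2) (S : chartRing c j)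
    (F : Polynomial (R ⧸ Ideal.span (Set.range c))) (hF0 : F ≠ 0)
    (hF : Ideal.Quotient.mk (Ideal.span {chartBase c j (c j)}) S =
      chartQuotMap c j (Polynomial.eval₂ (MvPolynomial.C : _ →+* MvPolynomial {l : Fin 3 // l ≠ j} (R ⧸ Ideal.span (Set.range c)))
        (MvPolynomial.X ⟨a, hja⟩) F)) :
    {w : PrimeSpectrum (chartRing c j) | chartBase c j (c j) ∈ w.asIdeal ∧ chartGen c j 2 ∈ w.asIdeal ∧ S ∈ w.asIdeal}.Finite ∧
      {w : PrimeSpectrum (chartRing c j) | chartBase c j (c j) ∈ w.asIdeal ∧ chartGen c j 2 ∈ w.asIdeal ∧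
        S ∈ w.asIdeal}.ncard ≤ F.natDegree := by
  classical
  haveI hImax : (Ideal.span (Set.range c)).IsMaximal := by rw [hc]; exact maximalIdeal.isMaximal R
  letI : Field (R ⧸ Ideal.span (Set.range c)) := Ideal.Quotient.field _
  set f := (chartQuotEquiv c j (isQuasiRegular_of_span_eq h3 c hc)).symm.toRingHom.comp
    (Ideal.Quotient.mk (Ideal.span {chartBase c j (c j)})) with hf
  set ι : Polynomial (R ⧸ Ideal.span (Set.range c)) →+* MvPolynomial {l : Fin 3 // l ≠ j} (R ⧸ Ideal.span (Set.range c)) :=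
    Polynomial.eval₂RingHom MvPolynomial.C (MvPolynomial.X ⟨a, hja⟩) with hι
  have hσ : ∀ l : {l : Fin 3 // l ≠ j}, l = ⟨a, hja⟩ ∨ l = ⟨2, h2j⟩ := by
    rintro ⟨l, hl⟩
    have : l = a ∨ l = 2 := by
      rcases a with ⟨a, ha⟩; rcases j with ⟨j, hj⟩; rcases l with ⟨l, hl'⟩
      simp only [ne_eq, Fin.ext_iff, Fin.val_two] at hja h2j ha2 hl ⊢
      omega
    rcases this with rfl | rfl
    · exact Or.inl rfl
    · exact Or.inr rfl
  have hab : (⟨a, hja⟩ : {l : Fin 3 // l ≠ j}) ≠ ⟨2, h2j⟩ := fun h => ha2 (congrArg Subtype.val h)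
  have hfS : f S = ι F := by
    rw [hf, RingHom.comp_apply, RingEquiv.toRingHom_eq_coe, RingHom.coe_coe, RingEquiv.symm_apply_eq, chartQuotEquiv_apply, hF,
      hι, Polynomial.coe_eval₂RingHom]
  -- the injection `w ↦ ι⁻¹(f(w))`
  obtain ⟨hfinF, hcardF⟩ := ncard_primes_mem_le_natDegree F hF0
  set g : PrimeSpectrum (chartRing c j) → Ideal (Polynomial (R ⧸ Ideal.span (Set.range c))) :=
    fun w => (w.asIdeal.map f).comap ι with hg
  have hmaps : ∀ w ∈ {w : PrimeSpectrum (chartRing c j) | chartBase c j (c j) ∈ w.asIdeal ∧ chartGen c j 2 ∈ w.asIdeal ∧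
      S ∈ w.asIdeal}, g w ∈ {𝔭 : Ideal (Polynomial (R ⧸ Ideal.span (Set.range c))) | 𝔭.IsPrime ∧ F ∈ 𝔭} := by
    rintro w ⟨hcj, -, hS⟩
    have hker : RingHom.ker f ≤ w.asIdeal := by
      intro x hx
      have := comap_chartQuotLift_map h3 c hc j hcj
      rw [← this, Ideal.mem_comap]
      rw [RingHom.mem_ker] at hx
      rw [← hf, hx]; exact zero_mem _
    haveI : (w.asIdeal.map f).IsPrime := Ideal.map_isPrime_of_surjective (chartQuotLift_surjective h3 c hc j) hker
    refine ⟨Ideal.IsPrime.comap ι, ?_⟩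
    show F ∈ (w.asIdeal.map f).comap ι
    rw [Ideal.mem_comap, ← hfS]
    exact Ideal.mem_map_of_mem f hS
  have hinj : Set.InjOn g {w : PrimeSpectrum (chartRing c j) | chartBase c j (c j) ∈ w.asIdeal ∧ chartGen c j 2 ∈ w.asIdeal ∧
      S ∈ w.asIdeal} := by
    rintro w ⟨hcj, h2, -⟩ w' ⟨hcj', h2', -⟩ hww'
    have hb : (MvPolynomial.X ⟨2, h2j⟩ : MvPolynomial {l : Fin 3 // l ≠ j} (R ⧸ Ideal.span (Set.range c))) ∈ w.asIdeal.map f := by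
      rw [← chartQuotLift_chartGen h3 c hc j 2 h2j]; exact Ideal.mem_map_of_mem f h2
    have hb' : (MvPolynomial.X ⟨2, h2j⟩ : MvPolynomial {l : Fin 3 // l ≠ j} (R ⧸ Ideal.span (Set.range c))) ∈ w'.asIdeal.map f := by
      rw [← chartQuotLift_chartGen h3 c hc j 2 h2j]; exact Ideal.mem_map_of_mem f h2'
    have hgw : g w = (w.asIdeal.map f).comap ι := rfl
    have hgw' : g w' = (w'.asIdeal.map f).comap ι := rfl
    have heq : w.asIdeal.map f = w'.asIdeal.map f :=
      le_antisymm (le_of_comap_line_le hσ hab hb hb' (by rw [← hgw, ← hgw', hww']))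
        (le_of_comap_line_le hσ hab hb' hb (by rw [← hgw, ← hgw', hww']))
    apply PrimeSpectrum.ext
    rw [← comap_chartQuotLift_map h3 c hc j hcj, ← comap_chartQuotLift_map h3 c hc j hcj', ← hf, heq]
  refine ⟨Set.Finite.of_finite_image (hfinF.subset ?_) hinj, (Set.ncard_le_ncard_of_injOn g hmaps hinj hfinF).trans hcardF⟩
  rintro _ ⟨w, hw, rfl⟩
  exact hmaps w hw

end Chart

end MohWindowSurface

end CampaignW46

end Summit.ResolutionOfSingularities.ResolutionOfSingularities.Theorems

end
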